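import Mathlib.FieldTheory.IsRealClosed.Basic
import Mathlib.FieldTheory.Galois.Basic
import Mathlib.FieldTheory.KummerExtension
import Mathlib.FieldTheory.PrimitiveElement
import Mathlib.FieldTheory.SplittingField.Construction
import Mathlib.GroupTheory.Sylow
import Mathlib.Algebra.Polynomial.SpecificDegree
import Mathlib.Data.Sign.Basic
import Mathlib.RingTheory.UniqueFactorizationDomain.Basic
import HarnessLib

/-!
# Real closed fields: the algebraic closure of `R(i)` and the intermediate value property

For a real closed field `R` in Mathlib's sense (`IsRealClosed R`: every element or its negative is
a square, every odd-degree polynomial has a root; with its field order `[LinearOrder R]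
[IsStrictOrderedRing R]`) we prove the algebraic half of the classical characterisation of real
closed fields (Basu–Pollack–Roy 2006, Thm. 2.11, (a) ⇒ (b) ⇒ (c)):

* `exists_eq_add_mul_of_mem_adjoin`, `exists_mem_adjoin_mul_self_eq`: every element of
  `R(i)` (`i * i = -1`, inside any field extension) is of the form `a + b i` and is a square in
  `R(i)` ("the classical method for solving polynomials of degree 2 works in `R[i]`");
* `exists_finrank_eq_two_pow`: a finite Galois extension of `R` has degree a power of `2`
  (Sylow `2`-subgroup + primitive element + odd-degree roots; E. Artin's argument);
* `finrank_eq_two_of_mul_self_eq_neg_one`: a finite Galois extension of `R` containing a square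
  root of `-1` has degree `2` (Kummer theory in degree `2`: a quadratic extension of `R(i)` would
  be generated by a square root, but everything in `R(i)` is a square) — i.e. `R(i)` is
  algebraically closed, Thm. 2.11 (a) ⇒ (b);
* `natDegree_le_two_of_irreducible`: irreducible polynomials over `R` have degree `≤ 2`
  (Basu–Pollack–Roy 2006, Prop. 2.19);
* `sign_eval_eq_of_irreducible_of_natDegree_eq_two`: an irreducible quadratic has the constant sign of its
  leading coefficient (Basu–Pollack–Roy 2006, Exercise 2.9);
* `exists_root_of_eval_mul_eval_neg` (**intermediate value property**, Thm. 2.11 (a) ⇒ (c)):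
  if `P(a) P(b) < 0` with `a < b` then `P` has a root in `(a, b)`.

These are the inputs for the "calculus" of univariate polynomials over real closed fields
(Rolle, mean value, monotonicity; `Literature/FieldTheory/RealClosedField/Calculus.lean`) and
ultimately for Tarski's theorem on the completeness of the theory of real closed fields.

## Mathlib search

Mathlib (this pin) has `IsRealClosed` with only elementary consequences
(`IsSquare.of_nonneg`, `IsRealClosed.exists_isRoot_of_odd_natDegree`; the file lists
"equivalent conditions for a real field to be real closed" as TODO), the Galois correspondence
(`IsGalois.card_aut_eq_finrank`, `IntermediateField.finrank_fixedField_eq_card`), Sylow theory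
(`Sylow.card_eq_multiplicity`, `Sylow.exists_subgroup_card_pow_prime`), the primitive element
theorem and Kummer theory (`exists_root_adjoin_eq_top_of_isCyclic`). It has no statement that
`R(i)` is algebraically closed for `R` real closed and no intermediate value property for
polynomials over real closed fields (only over `ℝ`, analytically).

## Proof route

We follow E. Artin's Galois-theoretic proof (as in Bochnak–Coste–Roy, *Real Algebraic
Geometry*, Thm. 1.2.2) rather than the symmetric-function induction printed in
Basu–Pollack–Roy, because Mathlib has all the Galois-theoretic ingredients.

## References

* S. Basu, R. Pollack, M.-F. Roy, *Algorithms in Real Algebraic Geometry*, 2nd ed., Springer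
  (2006), §2.1: Thm. 2.11, Prop. 2.19, Exercise 2.9, Prop. 2.20.
* J. Bochnak, M. Coste, M.-F. Roy, *Real Algebraic Geometry*, Springer (1998), Thm. 1.2.2.
-/

noncomputable section

open Polynomial Module

namespace Literature.FieldTheory.RealClosedField

variable {R : Type*} [Field R] [LinearOrder R] [IsStrictOrderedRing R]

/-! ### Square roots in `R` and in `R(i)` -/

section Sqrt

variable [IsRealClosed R]

/-- In a real closed field every nonnegative element has a nonnegative square root
(Basu–Pollack–Roy 2006, §2.1, definition of real closed field: the positive cone is the set of
squares). [cite: BasuPollackRoy2006, §2.1 (p. 34, definition of real closed field)] -/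
theorem exists_nonneg_mul_self_eq {x : R} (hx : 0 ≤ x) : ∃ r : R, 0 ≤ r ∧ r * r = x := by
  obtain ⟨r, hr⟩ := IsSquare.of_nonneg hx
  exact ⟨|r|, abs_nonneg r, by rw [abs_mul_abs_self]; exact hr.symm⟩

/-- The real and imaginary parts of a square root of `a + b i`: for all `a b` in a real closed
field there are `u v` with `u² - v² = a` and `2 u v = b` (Basu–Pollack–Roy 2006, proof of
Thm. 2.11: "the classical method for solving polynomials of degree 2 works in `R[i]`").
[cite: BasuPollackRoy2006, Thm. 2.11 (proof, (a) ⇒ (b))] -/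
theorem exists_sq_sub_sq_eq_and_two_mul_eq (a b : R) :
    ∃ u v : R, u * u - v * v = a ∧ 2 * u * v = b := by
  obtain ⟨r, hr0, hr⟩ :=
    exists_nonneg_mul_self_eq (add_nonneg (mul_self_nonneg a) (mul_self_nonneg b))
  have hra : |a| ≤ r := by
    rw [mul_self_le_mul_self_iff (abs_nonneg a) hr0, abs_mul_abs_self, hr]
    nlinarith [mul_self_nonneg b]
  have h1 : 0 ≤ (r + a) / 2 := by
    have := (abs_le.mp hra).1; linarith
  have h2 : 0 ≤ (r - a) / 2 := by
    have := (abs_le.mp hra).2; linarith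
  obtain ⟨u, hu0, hu⟩ := exists_nonneg_mul_self_eq h1
  obtain ⟨w, hw0, hw⟩ := exists_nonneg_mul_self_eq h2
  have huw : 2 * u * w = |b| := by
    have hsq : (2 * u * w) * (2 * u * w) = |b| * |b| := by
      rw [abs_mul_abs_self]
      calc (2 * u * w) * (2 * u * w) = 4 * (u * u) * (w * w) := by ring
        _ = 4 * ((r + a) / 2) * ((r - a) / 2) := by rw [hu, hw]
        _ = r * r - a * a := by ring
        _ = b * b := by rw [hr]; ring
    have hnn : 0 ≤ 2 * u * w := by positivity
    rcases mul_self_eq_mul_self_iff.mp hsq with h | h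
    · exact h
    · have hb : |b| = 0 := le_antisymm (by linarith [abs_nonneg b]) (abs_nonneg b)
      rw [h, hb, neg_zero]
  refine ⟨u, if 0 ≤ b then w else -w, ?_, ?_⟩
  · have : u * u - w * w = a := by rw [hu, hw]; ring
    split_ifs <;> simpa using this
  · split_ifs with hb
    · rw [huw, abs_of_nonneg hb]
    · rw [← mul_neg_one, ← mul_assoc, huw, abs_of_neg (not_le.mp hb)]; ring

end Sqrt

section AdjoinI

variable {E : Type*} [Field E] [Algebra R E] {i : E}

open IntermediateField

/-- Elements of `R(i)`, `i² = -1`, are of the form `a + b i` with `a b ∈ R`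
(Basu–Pollack–Roy 2006, Notation 2.18: "we can identify `R[i]` with `R²`").
[cite: BasuPollackRoy2006, Notation 2.18] -/
theorem exists_eq_add_mul_of_mem_adjoin (hi : i * i = -1) {x : E} (hx : x ∈ R⟮i⟯) :
    ∃ a b : R, x = algebraMap R E a + algebraMap R E b * i := by
  refine IntermediateField.adjoin_induction _ (p := fun x _ =>
    ∃ a b : R, x = algebraMap R E a + algebraMap R E b * i) ?_ ?_ ?_ ?_ ?_ hx
  · intro x hx
    rw [Set.mem_singleton_iff] at hx
    exact ⟨0, 1, by simp [hx]⟩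
  · intro a
    exact ⟨a, 0, by simp⟩
  · rintro x y - - ⟨a, b, rfl⟩ ⟨c, d, rfl⟩
    exact ⟨a + c, b + d, by simp only [map_add]; ring⟩
  · rintro x - ⟨a, b, rfl⟩
    by_cases h0 : a = 0 ∧ b = 0
    · exact ⟨0, 0, by simp [h0.1, h0.2]⟩
    · have hn : a * a + b * b ≠ 0 := fun h => h0 (mul_self_add_mul_self_eq_zero.mp h)
      refine ⟨a / (a * a + b * b), -(b / (a * a + b * b)), ?_⟩
      have hn' : algebraMap R E (a * a + b * b) ≠ 0 := by
        rwa [Ne, map_eq_zero_iff _ (algebraMap R E).injective]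
      apply inv_eq_of_mul_eq_one_right
      rw [map_div₀, map_neg, map_div₀]
      rw [map_add, map_mul, map_mul] at hn' ⊢
      set A := algebraMap R E a with hA
      set B := algebraMap R E b with hB
      have key : (A + B * i) * (A / (A * A + B * B) + -(B / (A * A + B * B)) * i) =
          (A * A - B * B * (i * i)) / (A * A + B * B) := by ring
      rw [key, hi, show A * A - B * B * (-1) = A * A + B * B by ring]
      exact div_self hn'
  · rintro x y - - ⟨a, b, rfl⟩ ⟨c, d, rfl⟩
    refine ⟨a * c - b * d, a * d + b * c, ?_⟩
    simp only [map_sub, map_mul, map_add]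
    linear_combination (algebraMap R E b * algebraMap R E d) * hi

omit [LinearOrder R] [IsStrictOrderedRing R] in
/-- Conversely, `a + b i ∈ R(i)`. [folklore] -/
theorem add_mul_mem_adjoin (i : E) (a b : R) :
    algebraMap R E a + algebraMap R E b * i ∈ R⟮i⟯ :=
  add_mem (IntermediateField.algebraMap_mem _ _)
    (mul_mem (IntermediateField.algebraMap_mem _ _) (mem_adjoin_simple_self R i))

variable [IsRealClosed R]

/-- Every element of `R(i)` is a square in `R(i)` when `R` is real closed (Basu–Pollack–Roy 2006,
proof of Thm. 2.11, (a) ⇒ (b): "the classical method for solving polynomials of degree 2 works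
in `R[i]` when `R` is real closed"). [cite: BasuPollackRoy2006, Thm. 2.11 (proof, (a) ⇒ (b))] -/
theorem exists_mem_adjoin_mul_self_eq (hi : i * i = -1) {x : E} (hx : x ∈ R⟮i⟯) :
    ∃ y ∈ R⟮i⟯, y * y = x := by
  obtain ⟨a, b, rfl⟩ := exists_eq_add_mul_of_mem_adjoin hi hx
  obtain ⟨u, v, h1, h2⟩ := exists_sq_sub_sq_eq_and_two_mul_eq a b
  refine ⟨algebraMap R E u + algebraMap R E v * i, add_mul_mem_adjoin i u v, ?_⟩
  rw [← h1, ← h2]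
  simp only [map_sub, map_mul, map_ofNat]
  linear_combination (algebraMap R E v * algebraMap R E v) * hi

end AdjoinI

/-! ### Finite Galois extensions of a real closed field -/

section Galois

variable [IsRealClosed R]
variable {E : Type*} [Field E] [Algebra R E] [FiniteDimensional R E]

/-- **E. Artin.** The degree of a finite Galois extension of a real closed field is a power of
`2`: the fixed field of a Sylow `2`-subgroup of the Galois group has odd degree, is simple, and
its generator has an odd-degree minimal polynomial, which has a root in `R`, so that fixed field
is `R` itself (Bochnak–Coste–Roy 1998, proof of Thm. 1.2.2; Basu–Pollack–Roy 2006, Thm. 2.11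
(a) ⇒ (b)). [cite: BasuPollackRoy2006, Thm. 2.11 ((a) ⇒ (b))] -/
theorem exists_finrank_eq_two_pow [IsGalois R E] : ∃ k : ℕ, finrank R E = 2 ^ k := by
  classical
  haveI : Fact (Nat.Prime 2) := ⟨Nat.prime_two⟩
  obtain ⟨P⟩ : Nonempty (Sylow 2 (E ≃ₐ[R] E)) := inferInstance
  set F : IntermediateField R E := IntermediateField.fixedField (P : Subgroup (E ≃ₐ[R] E))
    with hFdef
  have hFE : finrank F E = Nat.card P := IntermediateField.finrank_fixedField_eq_card _
  have htower : finrank R F * finrank F E = finrank R E := Module.finrank_mul_finrank R F E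
  have hG : Nat.card (E ≃ₐ[R] E) = finrank R E := IsGalois.card_aut_eq_finrank R E
  have hP : Nat.card P = 2 ^ (Nat.card (E ≃ₐ[R] E)).factorization 2 :=
    Sylow.card_eq_multiplicity P
  have hE0 : finrank R E ≠ 0 := Module.finrank_pos.ne'
  -- `finrank R F` is the odd part of `finrank R E`
  have hF : finrank R F = finrank R E / 2 ^ (finrank R E).factorization 2 := by
    rw [← hG, ← hP, ← hFE, hG, ← htower, Nat.mul_div_cancel _ Module.finrank_pos]
  have hodd : Odd (finrank R F) := by
    rw [Nat.odd_iff, ← Nat.two_dvd_ne_zero, hF]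
    exact Nat.not_dvd_ordCompl Nat.prime_two hE0
  -- primitive element of `F / R`; its minimal polynomial has odd degree, hence degree one
  obtain ⟨α, hα⟩ := Field.exists_primitive_element R F
  have hint : IsIntegral R α := IsIntegral.of_finite R α
  have hdeg : finrank R F = (minpoly R α).natDegree := by
    rw [← IntermediateField.adjoin.finrank hint, hα, IntermediateField.finrank_top']
  obtain ⟨x, hx⟩ := IsRealClosed.exists_isRoot_of_odd_natDegree (f := minpoly R α) (hdeg ▸ hodd)
  have h1 : (minpoly R α).degree = 1 :=
    degree_eq_one_of_irreducible_of_root (minpoly.irreducible hint) hx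
  have hF1 : finrank R F = 1 := by
    rw [hdeg]
    exact natDegree_eq_of_degree_eq_some h1
  refine ⟨(Nat.card (E ≃ₐ[R] E)).factorization 2, ?_⟩
  rw [← hP, ← hFE, ← htower, hF1, one_mul]

omit [IsRealClosed R] [FiniteDimensional R E] in
/-- The characteristic of an intermediate field of `E / R` is zero. [folklore] -/
theorem charZero_intermediateField (K : IntermediateField R E) : CharZero K :=
  charZero_of_injective_algebraMap (algebraMap R K).injective

/-- **`R(i)` is algebraically closed** (Basu–Pollack–Roy 2006, Thm. 2.11 (a) ⇒ (b)), in the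
form: a finite Galois extension `E` of a real closed field `R` containing a square root `i` of
`-1` has degree `[E : R] = 2`, i.e. `E = R(i)`. Proof: `[E : R] = 2 ^ k`
(`exists_finrank_eq_two_pow`), so `[E : R(i)] = 2 ^ j`; if `j ≥ 1` a subgroup of index `2` of
`Gal(E / R(i))` (Sylow) cuts out a quadratic, hence Kummer, extension `L = R(i)(√a)` of `R(i)`,
which is impossible because every `a ∈ R(i)` is already a square in `R(i)`
(`exists_mem_adjoin_mul_self_eq`). [cite: BasuPollackRoy2006, Thm. 2.11 ((a) ⇒ (b))] -/
theorem finrank_eq_two_of_mul_self_eq_neg_one [IsGalois R E] (i : E) (hi : i * i = -1) :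
    finrank R E = 2 := by
  classical
  haveI : Fact (Nat.Prime 2) := ⟨Nat.prime_two⟩
  obtain ⟨k, hk⟩ := exists_finrank_eq_two_pow (R := R) (E := E)
  set K : IntermediateField R E := IntermediateField.adjoin R {i} with hKdef
  haveI : CharZero K := charZero_intermediateField K
  -- `[K : R] = 2`
  have hint : IsIntegral R i := IsIntegral.of_finite R i
  have hKR : finrank R K = 2 := by
    rw [hKdef, IntermediateField.adjoin.finrank hint]
    apply le_antisymm
    · have hdvd : minpoly R i ∣ X ^ 2 + 1 := minpoly.dvd R i (by simp [sq, hi])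
      have hne : (X ^ 2 + 1 : R[X]) ≠ 0 := by
        apply_fun fun p => p.coeff 0
        simp
      have := natDegree_le_of_dvd hdvd hne
      have h2 : (X ^ 2 + 1 : R[X]).natDegree = 2 := by
        rw [← C_1, natDegree_X_pow_add_C]
      rwa [h2] at this
    · rw [minpoly.two_le_natDegree_iff hint]
      rintro ⟨r, hr⟩
      have h1 : algebraMap R E (r * r) = algebraMap R E (-1) := by
        rw [map_mul, map_neg, map_one, hr, hi]
      have h2 : r * r = -1 := (algebraMap R E).injective h1
      have h3 : (0 : R) ≤ r * r := mul_self_nonneg r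
      rw [h2] at h3
      exact absurd h3 (by norm_num)
  -- `[E : K] = 2 ^ j`
  have htower : finrank R K * finrank K E = finrank R E := Module.finrank_mul_finrank R K E
  have hdvd : finrank K E ∣ 2 ^ k := Dvd.intro_left _ (htower.trans hk)
  obtain ⟨j, -, hj⟩ := (Nat.dvd_prime_pow Nat.prime_two).mp hdvd
  suffices hj0 : j = 0 by
    rw [← htower, hKR, hj, hj0, pow_zero, mul_one]
  by_contra hj0
  -- a subgroup of index two of `Gal(E / K)` and its fixed field `L`, quadratic over `K`
  have hG : Nat.card (E ≃ₐ[K] E) = 2 ^ j := by rw [IsGalois.card_aut_eq_finrank, hj]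
  obtain ⟨H, hH⟩ := Sylow.exists_subgroup_card_pow_prime 2 (G := E ≃ₐ[K] E) (n := j - 1)
    (by rw [hG]; exact pow_dvd_pow 2 (Nat.sub_le j 1))
  set L : IntermediateField K E := IntermediateField.fixedField H with hLdef
  have hLE : finrank L E = 2 ^ (j - 1) := by
    rw [hLdef, IntermediateField.finrank_fixedField_eq_card, hH]
  have hKL : finrank K L = 2 := by
    have h := Module.finrank_mul_finrank K L E
    rw [hLE, hj] at h
    have h2 : (2 : ℕ) ^ j = 2 * 2 ^ (j - 1) := by
      rw [← pow_succ', Nat.sub_add_cancel (Nat.pos_of_ne_zero hj0)]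
    rw [h2] at h
    exact Nat.eq_of_mul_eq_mul_right (pow_pos two_pos _) h
  -- `L / K` is a Kummer extension of degree two: `L = K(α)` with `α ^ 2 ∈ K`
  haveI : Algebra.IsQuadraticExtension K L := { finrank_eq_two' := hKL }
  have hroots : (primitiveRoots (finrank K L) K).Nonempty := by
    refine ⟨-1, ?_⟩
    rw [hKL, mem_primitiveRoots two_pos]
    exact IsPrimitiveRoot.neg_one 0 (by decide)
  obtain ⟨α, ⟨a, ha⟩, hα⟩ := exists_root_adjoin_eq_top_of_isCyclic K L hroots
  rw [hKL] at ha
  -- but `a` is a square in `K`, so `α ∈ K`, contradicting `K(α) = L ≠ K`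
  obtain ⟨y, hyK, hy⟩ := exists_mem_adjoin_mul_self_eq hi a.2
  set b : K := ⟨y, hyK⟩ with hbdef
  have hab : a = b * b := Subtype.ext hy.symm
  have hprod : (α - algebraMap K L b) * (α + algebraMap K L b) = 0 := by
    have h' : α ^ 2 = algebraMap K L b * algebraMap K L b := by rw [← map_mul, ← hab, ha]
    linear_combination h'
  have hαK : α ∈ (⊥ : IntermediateField K L) := by
    rcases mul_eq_zero.mp hprod with h | h
    · rw [sub_eq_zero] at h
      rw [h]
      exact IntermediateField.algebraMap_mem _ _
    · rw [add_eq_zero_iff_eq_neg] at h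
      rw [h]
      exact neg_mem (IntermediateField.algebraMap_mem _ _)
  have hbot : (⊤ : IntermediateField K L) = ⊥ := by
    rw [← hα]
    exact IntermediateField.adjoin_simple_eq_bot_iff.mpr hαK
  have h1 : finrank K (⊤ : IntermediateField K L) = 1 := by
    rw [hbot, IntermediateField.finrank_bot]
  rw [IntermediateField.finrank_top', hKL] at h1
  exact absurd h1 (by norm_num)

end Galois

/-! ### Irreducible polynomials and the intermediate value property -/

section IVT

variable [IsRealClosed R]

/-- **Irreducible polynomials over a real closed field have degree at most two**
(Basu–Pollack–Roy 2006, Prop. 2.19: the irreducible factors are linear or of the form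
`(X - c)² + d²`). Proof: the splitting field of `f · (X² + 1)` is a finite Galois extension of
`R` containing `i`, hence of degree `2` (`finrank_eq_two_of_mul_self_eq_neg_one`), and it
contains a root of `f`, whose minimal polynomial is `f` up to a constant.
[cite: BasuPollackRoy2006, Prop. 2.19] -/
theorem natDegree_le_two_of_irreducible {f : R[X]} (hf : Irreducible f) : f.natDegree ≤ 2 := by
  set g : R[X] := f * (X ^ 2 + 1) with hgdef
  have hf0 : f ≠ 0 := hf.ne_zero
  have hq0 : (X ^ 2 + 1 : R[X]) ≠ 0 := by
    apply_fun fun p => p.coeff 0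
    simp
  have hg0 : g ≠ 0 := mul_ne_zero hf0 hq0
  let E := g.SplittingField
  haveI : IsGalois R E := {}
  have hsplit : (g.map (algebraMap R E)).Splits := SplittingField.splits g
  have hg0' : g.map (algebraMap R E) ≠ 0 := (Polynomial.map_ne_zero_iff (algebraMap R E).injective).mpr hg0
  -- a square root of `-1` in `E`
  have hsq : ((X ^ 2 + 1 : R[X]).map (algebraMap R E)).Splits :=
    hsplit.of_dvd hg0' (Polynomial.map_dvd _ (dvd_mul_left _ _))
  obtain ⟨i, hi⟩ := hsq.exists_eval_eq_zero (by
    rw [degree_map, ← C_1, degree_X_pow_add_C two_pos]; decide)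
  have hi' : i * i = -1 := by
    simp only [Polynomial.map_add, Polynomial.map_pow, map_X, Polynomial.map_one, eval_add,
      eval_pow, eval_X, eval_one] at hi
    rw [← sq]; linear_combination hi
  have hE2 : finrank R E = 2 := finrank_eq_two_of_mul_self_eq_neg_one i hi'
  -- a root of `f` in `E`
  have hsf : (f.map (algebraMap R E)).Splits :=
    hsplit.of_dvd hg0' (Polynomial.map_dvd _ (dvd_mul_right _ _))
  obtain ⟨β, hβ⟩ := hsf.exists_eval_eq_zero (by
    rw [degree_map]
    exact fun h => hf.not_isUnit (isUnit_iff_degree_eq_zero.mpr h))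
  have haeval : aeval β f = 0 := by rwa [aeval_def, eval₂_eq_eval_map]
  have hmin := minpoly.eq_of_irreducible hf haeval
  have hlc : f.leadingCoeff⁻¹ ≠ 0 := inv_ne_zero (leadingCoeff_ne_zero.mpr hf0)
  calc f.natDegree = (f * C f.leadingCoeff⁻¹).natDegree := (natDegree_mul_C hlc).symm
    _ = (minpoly R β).natDegree := by rw [hmin]
    _ ≤ finrank R E := minpoly.natDegree_le β
    _ = 2 := hE2

/-- An irreducible quadratic over a real closed field has everywhere the (non-zero) sign of its
leading coefficient: `4 c · p(x) = (2 c x + d)² - Δ` with discriminant `Δ < 0`, since `Δ ≥ 0`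
would produce a root (Basu–Pollack–Roy 2006, Exercise 2.9).
[cite: BasuPollackRoy2006, Exercise 2.9] -/
theorem sign_eval_eq_of_irreducible_of_natDegree_eq_two {p : R[X]} (hp : Irreducible p)
    (hdeg : p.natDegree = 2) (x : R) :
    SignType.sign (p.eval x) = SignType.sign p.leadingCoeff := by
  have hp0 : p ≠ 0 := hp.ne_zero
  set c := p.coeff 2 with hc
  set d := p.coeff 1 with hd
  set e := p.coeff 0 with he
  have hlc : p.leadingCoeff = c := by rw [leadingCoeff, hdeg]
  have hc0 : c ≠ 0 := hlc ▸ leadingCoeff_ne_zero.mpr hp0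
  have heval : ∀ y, p.eval y = c * y ^ 2 + d * y + e := fun y => by
    rw [eval_eq_sum_range, hdeg]
    simp only [Finset.sum_range_succ, Finset.sum_range_zero, zero_add, pow_zero, mul_one,
      pow_one]
    ring
  -- no root
  have hnoroot : ∀ y, p.eval y ≠ 0 := by
    intro y hy
    have h1 := degree_eq_one_of_irreducible_of_root hp hy
    have h2 : p.natDegree = 1 := natDegree_eq_of_degree_eq_some h1
    omega
  have key : ∀ y, 4 * c * p.eval y = (2 * c * y + d) ^ 2 - (d ^ 2 - 4 * c * e) := fun y => by
    rw [heval]; ring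
  -- negative discriminant
  have hΔ : d ^ 2 - 4 * c * e < 0 := by
    by_contra hge
    push Not at hge
    obtain ⟨s, -, hs⟩ := exists_nonneg_mul_self_eq hge
    have h2c : 2 * c ≠ 0 := mul_ne_zero two_ne_zero hc0
    set y := (-d + s) / (2 * c) with hy
    have hy' : 2 * c * y + d = s := by
      rw [hy]; field_simp; ring
    have h4 := key y
    rw [hy', sq, hs, sub_self] at h4
    rcases mul_eq_zero.mp h4 with h | h
    · exact (mul_ne_zero four_ne_zero hc0) h
    · exact hnoroot y h
  have hpos : 0 < 4 * c * p.eval x := by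
    rw [key]; nlinarith [sq_nonneg (2 * c * x + d)]
  -- signs
  have hmul : SignType.sign c * SignType.sign (p.eval x) = 1 := by
    have h := sign_pos hpos
    rwa [sign_mul, sign_mul, sign_pos (four_pos : (0 : R) < 4), one_mul] at h
  have hsc : SignType.sign c ≠ 0 := sign_ne_zero.mpr hc0
  rw [hlc]
  revert hmul hsc
  generalize SignType.sign c = sc
  generalize SignType.sign (p.eval x) = sp
  revert sc sp
  decide

omit [IsRealClosed R] in
/-- A polynomial of degree one changing sign on `(a, b)` has its root in `(a, b)`. [folklore] -/
theorem exists_root_of_natDegree_eq_one {q : R[X]} (hq : q.natDegree = 1) {a b : R} (hab : a < b)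
    (hs : q.eval a * q.eval b < 0) : ∃ c ∈ Set.Ioo a b, q.eval c = 0 := by
  have hform := eq_X_add_C_of_natDegree_le_one hq.le
  set q₁ := q.coeff 1 with hq₁
  set q₀ := q.coeff 0 with hq₀
  have hq₁0 : q₁ ≠ 0 := by
    have : q.leadingCoeff ≠ 0 := leadingCoeff_ne_zero.mpr (by rintro rfl; simp at hq)
    rwa [leadingCoeff, hq] at this
  have heval : ∀ y, q.eval y = q₁ * y + q₀ := fun y => by
    conv_lhs => rw [hform]
    simp
  set r := -q₀ / q₁ with hr
  have hroot : q.eval r = 0 := by rw [heval, hr]; field_simp; ring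
  have hfac : ∀ y, q.eval y = q₁ * (y - r) := fun y => by rw [heval, hr]; field_simp; ring
  refine ⟨r, ⟨?_, ?_⟩, hroot⟩
  · by_contra hle
    push Not at hle
    rw [hfac, hfac] at hs
    have : 0 ≤ q₁ * (a - r) * (q₁ * (b - r)) := by
      have h1 : 0 ≤ a - r := sub_nonneg.mpr hle
      have h2 : 0 ≤ b - r := by linarith
      nlinarith [mul_self_nonneg q₁, mul_nonneg h1 h2]
    exact absurd hs (not_lt.mpr this)
  · by_contra hle
    push Not at hle
    rw [hfac, hfac] at hs
    have : 0 ≤ q₁ * (a - r) * (q₁ * (b - r)) := by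
      have h1 : a - r ≤ 0 := by linarith
      have h2 : b - r ≤ 0 := sub_nonpos.mpr hle
      nlinarith [mul_self_nonneg q₁, mul_nonneg_of_nonpos_of_nonpos h1 h2]
    exact absurd hs (not_lt.mpr this)

/-- **Intermediate value property for polynomials over a real closed field**
(Basu–Pollack–Roy 2006, Thm. 2.11, (a) ⇒ (c)): if `f(a) f(b) < 0` with `a < b` then `f` has a
root in `(a, b)`. Proof by induction along an irreducible factorisation: the factor changing
sign is linear (an irreducible quadratic has constant sign). [cite: BasuPollackRoy2006, Thm. 2.11 ((a) ⇒ (c))] -/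
theorem exists_root_of_eval_mul_eval_neg {f : R[X]} {a b : R} (hab : a < b)
    (hf : f.eval a * f.eval b < 0) : ∃ c ∈ Set.Ioo a b, f.eval c = 0 := by
  induction f using WfDvdMonoid.induction_on_irreducible with
  | zero => simp at hf
  | unit u hu =>
    exfalso
    rw [Polynomial.isUnit_iff_degree_eq_zero] at hu
    rw [eq_C_of_degree_eq_zero hu, eval_C, eval_C] at hf
    exact absurd hf (not_lt.mpr (mul_self_nonneg _))
  | mul g q hg0 hq ih =>
    rw [eval_mul, eval_mul, mul_mul_mul_comm] at hf
    by_cases hqs : q.eval a * q.eval b < 0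
    · -- the irreducible factor `q` changes sign: it is linear
      have hdq : q.natDegree ≤ 2 := natDegree_le_two_of_irreducible hq
      have hdq1 : 1 ≤ q.natDegree := by
        have := natDegree_pos_iff_degree_pos.mpr (degree_pos_of_irreducible hq)
        omega
      rcases Nat.le_succ_iff.mp hdq with h1 | h2
      · have h1' : q.natDegree = 1 := le_antisymm h1 hdq1
        obtain ⟨c, hc, hc0⟩ := exists_root_of_natDegree_eq_one h1' hab hqs
        exact ⟨c, hc, by rw [eval_mul, hc0, zero_mul]⟩
      · exfalso
        have ha := sign_eval_eq_of_irreducible_of_natDegree_eq_two hq h2 a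
        have hb := sign_eval_eq_of_irreducible_of_natDegree_eq_two hq h2 b
        have hs : SignType.sign (q.eval a * q.eval b) = -1 := sign_neg hqs
        rw [sign_mul, ha, hb] at hs
        have hlc : SignType.sign q.leadingCoeff ≠ 0 :=
          sign_ne_zero.mpr (leadingCoeff_ne_zero.mpr hq.ne_zero)
        revert hs hlc
        generalize SignType.sign q.leadingCoeff = s
        revert s
        decide
    · -- otherwise `g` changes sign
      have hq0 : q.eval a * q.eval b ≠ 0 := by
        intro h0
        rw [h0, zero_mul] at hf
        exact lt_irrefl _ hf
      have hqpos : 0 < q.eval a * q.eval b := lt_of_le_of_ne (not_lt.mp hqs) (Ne.symm hq0)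
      have hg : g.eval a * g.eval b < 0 := by
        by_contra hge
        push Not at hge
        exact absurd hf (not_lt.mpr (mul_nonneg hqpos.le hge))
      obtain ⟨c, hc, hc0⟩ := ih hg
      exact ⟨c, hc, by rw [eval_mul, hc0, mul_zero]⟩

/-- Intermediate value property, increasing form: `f(a) < 0 < f(b)`, `a < b` gives a root in
`(a, b)` (Basu–Pollack–Roy 2006, Thm. 2.11 (c)). [cite: BasuPollackRoy2006, Thm. 2.11 ((a) ⇒ (c))] -/
theorem exists_root_of_neg_of_pos {f : R[X]} {a b : R} (hab : a < b) (ha : f.eval a < 0)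
    (hb : 0 < f.eval b) : ∃ c ∈ Set.Ioo a b, f.eval c = 0 :=
  exists_root_of_eval_mul_eval_neg hab (mul_neg_of_neg_of_pos ha hb)

/-- Intermediate value property, decreasing form: `f(a) > 0 > f(b)`, `a < b` gives a root in
`(a, b)` (Basu–Pollack–Roy 2006, Thm. 2.11 (c)). [cite: BasuPollackRoy2006, Thm. 2.11 ((a) ⇒ (c))] -/
theorem exists_root_of_pos_of_neg {f : R[X]} {a b : R} (hab : a < b) (ha : 0 < f.eval a)
    (hb : f.eval b < 0) : ∃ c ∈ Set.Ioo a b, f.eval c = 0 :=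
  exists_root_of_eval_mul_eval_neg hab (mul_neg_of_pos_of_neg ha hb)

/-- A polynomial without roots on `[a, b]` has the same (non-zero) sign at `a` and `b`
(Basu–Pollack–Roy 2006, Prop. 2.20: `P` has constant sign on an interval where it does not
vanish). [cite: BasuPollackRoy2006, Prop. 2.20] -/
theorem sign_eval_eq_sign_eval_of_forall_ne_zero {f : R[X]} {a b : R} (hab : a ≤ b)
    (h : ∀ z ∈ Set.Icc a b, f.eval z ≠ 0) :
    SignType.sign (f.eval a) = SignType.sign (f.eval b) := by
  have ha : f.eval a ≠ 0 := h a (Set.left_mem_Icc.mpr hab)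
  have hb : f.eval b ≠ 0 := h b (Set.right_mem_Icc.mpr hab)
  rcases hab.eq_or_lt with rfl | hab'
  · rfl
  rcases lt_or_gt_of_ne ha with ha' | ha' <;> rcases lt_or_gt_of_ne hb with hb' | hb'
  · rw [sign_neg ha', sign_neg hb']
  · obtain ⟨r, hr, hr0⟩ := exists_root_of_neg_of_pos hab' ha' hb'
    exact absurd hr0 (h r (Set.Ioo_subset_Icc_self hr))
  · obtain ⟨r, hr, hr0⟩ := exists_root_of_pos_of_neg hab' ha' hb'
    exact absurd hr0 (h r (Set.Ioo_subset_Icc_self hr))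
  · rw [sign_pos ha', sign_pos hb']

end IVT

end Literature.FieldTheory.RealClosedField
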